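import Summits.FinalStateConjecture.FinalStateConjecture.Theorems.EIHFluxBalanceInertialRecessionStubSlavingCOERSymbol
import Literature.Geometry.Lorentzian.CoordBianchi

/-!
# Route EIHFluxBalance — `InertialRecession` (E′), stub `stub_frozenVacuumSlaving`:
# the FIRST-ORDER slot of the mixed Ricci components `Ric(♯n, e)`, `e ∈ ker n` — the coordinate
# shadow of the Codazzi (momentum-constraint) structure

Helper file for the crux `stmt-FinalStateConjecture-17403`
(`Summit.FinalStateConjecture.FinalStateConjecture.Theses.EIHFluxBalance.InertialRecession`, E′),
stub `stub_frozenVacuumSlaving`, roadmap `FVS_momentum_roadmap.md` steps (P4)/(P5) (claim note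
`COER_claim_note2.md`, (Q1)). Two fields of metric components `G, G'` on an open `V ∋ x` with the
same value at `x`, first derivatives differing by `DG'(x)(v) = DG(x)(v) + n(v) A` (`n` a covector,
`A` a symmetric bilinear form — two painted metrics with different first-order jets, `n = dx⁰`,
`A` the first variation of the summand) and second derivatives differing by
`D²G'(x)(v)(w) = D²G(x)(v)(w) + n(v) P(w) + n(w) P(v) + n(v) n(w) W` (`P` the tangential derivative
of the first-variation field, `W` anything). This file computes the change of the Christoffel map,
of its derivative and of the curvature endomorphism EXACTLY (they are polynomial of degree two in
`A`), in the form consumed by the momentum-row formula of the companion file.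

* `koszulCLM_eq_add_of_jet₁`, `chrAt_apply_eq_add_of_jet₁` — `K' = K + (n⊗A-Koszul)`,
  `Γ'(X)Y = Γ(X)Y + ½ ♯(n(X) A(Y,·) + n(Y) A(·,X) − A(X,Y) n)`;
* `fderiv_sharpAt_eq_sub_of_jet₁` — `D♯'(v) = D♯(v) − n(v) ♯ ∘ A ∘ ♯`;
* `fderiv_chrAt_apply_eq_add_of_jet₁` — `DΓ'(v)(X)Y − DΓ(v)(X)Y` in closed form (linear part in
  `(A, P, W)` plus the one quadratic term `−½ n(v) ♯A♯(ΔK(X)Y)`);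
* `riemAt_apply_eq_add_of_jet₁` — **`R'(X,Y)Z − R(X,Y)Z` exactly**, degree two in `A`;
  `ricAt_sub_eq_sum_coord` — `Ric' − Ric` as the basis trace of it (the form evaluated numerically
  by the all-boost momentum certificate);
* `ricAt_sharp_ker_eq_of_jet₂_along` — **the second-jet datum `W` is invisible in `Ric(♯n, e)`,
  `n(e) = 0`** (principal symbol on `(♯n, ker n)`; carrier `coer_ricAt_sharp_ker_jet2_s0`): the
  constraint rows see no second normal derivatives. Exact linearity in `(A, P)` of that component
  (cancellation of the `A`-quadratic trace) is verified in exact arithmetic on random jets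
  (`work/coer/momslot`) and is recovered numerically wherever the formula is evaluated.

Pure coordinate tensor algebra (`Literature.Geometry.Lorentzian.MetricCoord`); no definitions, no
named facts, no `sorry`.
-/

set_option linter.dupNamespace false
set_option maxSynthPendingDepth 3

noncomputable section

open Set Function ContinuousLinearMap Literature.Geometry.Lorentzian
  Literature.Geometry.Lorentzian.MetricCoord

namespace Summit.FinalStateConjecture.FinalStateConjecture.Theorems.SublinearIsFree.Slaving

section Jet1

variable {E : Type*} [NormedAddCommGroup E] [NormedSpace ℝ E] [CompleteSpace E]
  {G G' : E → E →L[ℝ] E →L[ℝ] ℝ} {V : Set E} {x : E} {n : E →L[ℝ] ℝ} {A : E →L[ℝ] E →L[ℝ] ℝ}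

omit [CompleteSpace E] in
/-- **The Koszul form under a first-jet change along `n ⊗ A`**:
`K'(X)(Y) = K(X)(Y) + n(X) A(Y,·) + n(Y) A(·,X) − A(X,Y) n`. [cite: ONeill1983, Ch. 3, Prop. 3.13] -/
theorem koszulCLM_eq_add_of_jet₁ (h1 : fderiv ℝ G' x = fderiv ℝ G x + n.smulRight A) (X Y : E) :
    koszulCLM G' x X Y = koszulCLM G x X Y + (n X • A Y + n Y • A.flip X - A X Y • n) := by
  ext Z
  simp only [koszulCLM_apply, h1, add_apply, ContinuousLinearMap.smulRight_apply, sub_apply,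
    FunLike.coe_smul, Pi.smul_apply, ContinuousLinearMap.flip_apply, smul_eq_mul]
  ring

omit [CompleteSpace E] in
/-- **The Christoffel map under a first-jet change along `n ⊗ A`** (same value at `x`):
`Γ'(X)Y = Γ(X)Y + ½ ♯(n(X) A(Y,·) + n(Y) A(·,X) − A(X,Y) n)`. [cite: ONeill1983, Ch. 3, Prop. 3.13] -/
theorem chrAt_apply_eq_add_of_jet₁ (h0 : G' x = G x)
    (h1 : fderiv ℝ G' x = fderiv ℝ G x + n.smulRight A) (X Y : E) :
    chrAt G' x X Y = chrAt G x X Y +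
      (2⁻¹ : ℝ) • sharpAt G x (n X • A Y + n Y • A.flip X - A X Y • n) := by
  have hS : sharpAt G' x = sharpAt G x := by simp only [sharpAt, h0]
  rw [chrAt_apply, chrAt_apply, hS, koszulCLM_eq_add_of_jet₁ h1, map_add, smul_add]

/-- **Index raising under a first-jet change along `n ⊗ A`**:
`D♯'(v) = D♯(v) − n(v) ♯ ∘ A ∘ ♯`. [cite: ONeill1983, Ch. 3, p. 60] -/
theorem fderiv_sharpAt_eq_sub_of_jet₁ (hG : IsMetricOn G V) (hG' : IsMetricOn G' V) (hx : x ∈ V)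
    (h0 : G' x = G x) (h1 : fderiv ℝ G' x = fderiv ℝ G x + n.smulRight A) (v : E) :
    fderiv ℝ (sharpAt G') x v =
      fderiv ℝ (sharpAt G) x v - n v • (sharpAt G x).comp (A.comp (sharpAt G x)) := by
  have hS : sharpAt G' x = sharpAt G x := by simp only [sharpAt, h0]
  rw [hG'.fderiv_sharpAt hx v, hG.fderiv_sharpAt hx v, hS, h1]
  simp only [add_apply, ContinuousLinearMap.smulRight_apply, ContinuousLinearMap.comp_add,
    ContinuousLinearMap.add_comp, ContinuousLinearMap.comp_smul, ContinuousLinearMap.smul_comp,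
    neg_add, sub_eq_add_neg]

/-- **The derivative of the Christoffel map under first- and second-jet changes along `n`.** With
`DG' = DG + n ⊗ A` and `D²G'(v) = D²G(v) + n(v) P + (w ↦ n(w) P(v)) + n(v) (w ↦ n(w) W)` at `x`
(same value):
`DΓ'(v)(X)Y = DΓ(v)(X)Y + ½ [D♯(v)(ΔK) − n(v) ♯A♯(K(X)Y) − n(v) ♯A♯(ΔK) + ♯(koszulOp(T v)(X)(Y))]`,
`ΔK = n(X)A(Y,·) + n(Y)A(·,X) − A(X,Y)n`, `T v` the second-jet change. [cite: ONeill1983, Ch. 3, Prop. 3.13] -/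
theorem fderiv_chrAt_apply_eq_add_of_jet₁ (hG : IsMetricOn G V) (hG' : IsMetricOn G' V)
    (hx : x ∈ V) (h0 : G' x = G x) (h1 : fderiv ℝ G' x = fderiv ℝ G x + n.smulRight A)
    {P : E →L[ℝ] E →L[ℝ] E →L[ℝ] ℝ} {W : E →L[ℝ] E →L[ℝ] ℝ}
    (h2 : ∀ v, fderiv ℝ (fderiv ℝ G') x v =
      fderiv ℝ (fderiv ℝ G) x v + (n v • P + n.smulRight (P v) + n v • n.smulRight W))
    (v X Y : E) :
    fderiv ℝ (chrAt G') x v X Y = fderiv ℝ (chrAt G) x v X Y + (2⁻¹ : ℝ) •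
      (fderiv ℝ (sharpAt G) x v (n X • A Y + n Y • A.flip X - A X Y • n)
        - n v • sharpAt G x (A (sharpAt G x (koszulCLM G x X Y)))
        - n v • sharpAt G x (A (sharpAt G x (n X • A Y + n Y • A.flip X - A X Y • n)))
        + sharpAt G x (koszulOp (n v • P + n.smulRight (P v) + n v • n.smulRight W) X Y)) := by
  have hS : sharpAt G' x = sharpAt G x := by simp only [sharpAt, h0]
  rw [hG'.fderiv_chrAt_apply_eq hx v X, hG.fderiv_chrAt_apply_eq hx v X, hS,
    fderiv_sharpAt_eq_sub_of_jet₁ hG hG' hx h0 h1 v, h2 v]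
  simp only [FunLike.coe_smul, Pi.smul_apply, add_apply, sub_apply, ContinuousLinearMap.comp_apply,
    koszulCLM_eq_add_of_jet₁ h1, map_add, map_sub, map_smul, smul_add, smul_sub]
  module

/-- **The curvature endomorphism under first- and second-jet changes along `n` — exact formula.**
With `S = ♯`, `Γ`, `K` the background objects at `x`, `dK(a,b) = n(a)A(b,·) + n(b)A(·,a) − A(a,b)n`,
`T(v) = n(v)P + n(·)P(v) + n(v)n(·)W`:
`R'(X,Y)Z = R(X,Y)Z + ½[D♯(X)dK(Y,Z) − n(X)♯A♯K(Y)Z − n(X)♯A♯dK(Y,Z) + ♯koszulOp(T X)(Y)(Z)] − (X ↔ Y)`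
`  + Γ(X)(½♯dK(Y,Z)) + ½♯dK(X, Γ'(Y)Z) − (X ↔ Y)`, `Γ'(Y)Z = Γ(Y)Z + ½♯dK(Y,Z)`
(O'Neill 1983, Lemma 3.38 expanded with `chrAt_apply_eq_add_of_jet₁`,
`fderiv_chrAt_apply_eq_add_of_jet₁`). Degree two in `A`; the trace over `X` at `(Y,Z) = (♯n, e)`,
`n(e) = 0`, is the momentum-row formula. [cite: ONeill1983, Ch. 3, Lemma 3.38] -/
theorem riemAt_apply_eq_add_of_jet₁ (hG : IsMetricOn G V) (hG' : IsMetricOn G' V)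
    (hx : x ∈ V) (h0 : G' x = G x) (h1 : fderiv ℝ G' x = fderiv ℝ G x + n.smulRight A)
    {P : E →L[ℝ] E →L[ℝ] E →L[ℝ] ℝ} {W : E →L[ℝ] E →L[ℝ] ℝ}
    (h2 : ∀ v, fderiv ℝ (fderiv ℝ G') x v =
      fderiv ℝ (fderiv ℝ G) x v + (n v • P + n.smulRight (P v) + n v • n.smulRight W))
    (X Y Z : E) :
    riemAt G' x X Y Z = riemAt G x X Y Z
      + (2⁻¹ : ℝ) • (fderiv ℝ (sharpAt G) x X (n Y • A Z + n Z • A.flip Y - A Y Z • n)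
          - n X • sharpAt G x (A (sharpAt G x (koszulCLM G x Y Z)))
          - n X • sharpAt G x (A (sharpAt G x (n Y • A Z + n Z • A.flip Y - A Y Z • n)))
          + sharpAt G x (koszulOp (n X • P + n.smulRight (P X) + n X • n.smulRight W) Y Z))
      - (2⁻¹ : ℝ) • (fderiv ℝ (sharpAt G) x Y (n X • A Z + n Z • A.flip X - A X Z • n)
          - n Y • sharpAt G x (A (sharpAt G x (koszulCLM G x X Z)))
          - n Y • sharpAt G x (A (sharpAt G x (n X • A Z + n Z • A.flip X - A X Z • n)))
          + sharpAt G x (koszulOp (n Y • P + n.smulRight (P Y) + n Y • n.smulRight W) X Z))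
      + (chrAt G x X ((2⁻¹ : ℝ) • sharpAt G x (n Y • A Z + n Z • A.flip Y - A Y Z • n))
          + (2⁻¹ : ℝ) • sharpAt G x
            (n X • A (chrAt G x Y Z + (2⁻¹ : ℝ) • sharpAt G x (n Y • A Z + n Z • A.flip Y - A Y Z • n))
              + n (chrAt G x Y Z + (2⁻¹ : ℝ) • sharpAt G x (n Y • A Z + n Z • A.flip Y - A Y Z • n))
                • A.flip X
              - A X (chrAt G x Y Z + (2⁻¹ : ℝ) • sharpAt G x (n Y • A Z + n Z • A.flip Y - A Y Z • n))
                • n))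
      - (chrAt G x Y ((2⁻¹ : ℝ) • sharpAt G x (n X • A Z + n Z • A.flip X - A X Z • n))
          + (2⁻¹ : ℝ) • sharpAt G x
            (n Y • A (chrAt G x X Z + (2⁻¹ : ℝ) • sharpAt G x (n X • A Z + n Z • A.flip X - A X Z • n))
              + n (chrAt G x X Z + (2⁻¹ : ℝ) • sharpAt G x (n X • A Z + n Z • A.flip X - A X Z • n))
                • A.flip Y
              - A Y (chrAt G x X Z + (2⁻¹ : ℝ) • sharpAt G x (n X • A Z + n Z • A.flip X - A X Z • n))
                • n)) := by
  rw [riemAt_apply, riemAt_apply, fderiv_chrAt_apply_eq_add_of_jet₁ hG hG' hx h0 h1 h2 X Y Z,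
    fderiv_chrAt_apply_eq_add_of_jet₁ hG hG' hx h0 h1 h2 Y X Z]
  simp only [chrAt_apply_eq_add_of_jet₁ h0 h1, map_add, map_smul]
  abel

/-- **The second-jet datum `W` is invisible in the mixed components `Ric(♯n, e)`, `n(e) = 0`.** If
`G', G''` both have the jets of the previous theorems with the same `A, P` and different `W`, then
`Ric''(♯n, e) = Ric'(♯n, e)`: they have the same `1`-jet and second jets differing by
`n ⊗ n ⊗ (W'' − W')`, and the principal symbol `σ(n)` of such a datum vanishes on `(♯n, ker n)`
(`ricAt_apply_eq_add_symbol_of_jets` pattern: `½[n(e)(…) + n(♯n)B(♯n,e) − n(♯n)B(♯n,e) − n(♯n)n(e) tr] = 0`).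
This is why the constraint rows do not see second normal derivatives. [cite: ONeill1983, Ch. 3, Lemma 3.52] -/
theorem ricAt_sharp_ker_eq_of_jet₂_along [FiniteDimensional ℝ E] (hG' : IsMetricOn G' V)
    {G'' : E → E →L[ℝ] E →L[ℝ] ℝ} (hG'' : IsMetricOn G'' V) (hx : x ∈ V) (h0 : G'' x = G' x)
    (h1 : fderiv ℝ G'' x = fderiv ℝ G' x) {B : E →L[ℝ] E →L[ℝ] ℝ}
    (h2 : ∀ v, fderiv ℝ (fderiv ℝ G'') x v = fderiv ℝ (fderiv ℝ G') x v + n v • n.smulRight B)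
    {e : E} (he : n e = 0) :
    ricAt G'' x (sharpAt G' x n) e = ricAt G' x (sharpAt G' x n) e := by
  rw [ricAt_apply_eq_add_symbol_of_jets hG' hG'' hx h0 h1 h2 (sharpAt G' x n) e, he]
  ring

omit [CompleteSpace E] in
/-- **The change of a Ricci component is the trace of the change of the curvature endomorphism**:
`Ric'(Y,Z) − Ric(Y,Z) = Σᵢ bⁱ(R'(bᵢ,Y)Z − R(bᵢ,Y)Z)` in any basis — combine with
`riemAt_apply_eq_add_of_jet₁` to read the change of `Ric(♯n, e)` off the jets (the quadratic terms
in `A` cancel in that component after summation; the linear part is the momentum-row formula).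
[cite: ONeill1983, Ch. 3, Lemma 3.52] -/
theorem ricAt_sub_eq_sum_coord [FiniteDimensional ℝ E] {ι : Type*} [Fintype ι]
    (b : Module.Basis ι ℝ E) (Y Z : E) :
    ricAt G' x Y Z - ricAt G x Y Z = ∑ i, b.coord i (riemAt G' x (b i) Y Z - riemAt G x (b i) Y Z) := by
  rw [ricAt_eq_sum_coord b, ricAt_eq_sum_coord b, ← Finset.sum_sub_distrib]
  refine Finset.sum_congr rfl fun i _ ↦ ?_
  rw [map_sub]

end Jet1

/-- **Registered one-line carrier form** (`coer_ricAt_sharp_ker_jet2_s0`) of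
`ricAt_sharp_ker_eq_of_jet₂_along` on `E4`. [cite: ONeill1983, Ch. 3, Lemma 3.52] -/
theorem coer_ricAt_sharp_ker_jet2_s0 : open Literature.Geometry.Lorentzian in ∀ {G' G'' : E4 → E4 →L[ℝ] E4 →L[ℝ] ℝ} {V : Set E4} {x : E4} {n : E4 →L[ℝ] ℝ}, MetricCoord.IsMetricOn G' V → MetricCoord.IsMetricOn G'' V → x ∈ V → G'' x = G' x → fderiv ℝ G'' x = fderiv ℝ G' x → ∀ {B : E4 →L[ℝ] E4 →L[ℝ] ℝ}, (∀ v, fderiv ℝ (fderiv ℝ G'') x v = fderiv ℝ (fderiv ℝ G') x v + n v • n.smulRight B) → ∀ {e : E4}, n e = 0 → MetricCoord.ricAt G'' x (MetricCoord.sharpAt G' x n) e = MetricCoord.ricAt G' x (MetricCoord.sharpAt G' x n) e :=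
  fun hG' hG'' hx h0 h1 _ h2 _ he ↦ ricAt_sharp_ker_eq_of_jet₂_along hG' hG'' hx h0 h1 h2 he

end Summit.FinalStateConjecture.FinalStateConjecture.Theorems.SublinearIsFree.Slaving
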